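import Summits.AtomisticToContinuum.HydrodynamicLimit.Theorems.InfluenceLocality.Negative.PhaseScript
import Literature.Analysis.FluidPDE.HardSphereTorusMeasure
import HarnessLib

/-!
# `InfluenceLocality` (stmt-AtomisticToContinuum-13916) — tube enclosure (stub `stub_tubeEnclosure`)

Line `ignition-cascade-refutation` (lead c3), Phase 2 (construction of `IgnitionTemplates`). The phase sets of the
eventual phase script (Negative/PhaseScript.lean) are FREE-FLIGHT TUBES on the flat torus `T3`: states `(t, x, v)`
with `‖v - v₀‖ ≤ δv` whose back-extrapolation to the nominal time `t₀`, `x + proj ((t₀ - t) • v)`, lies within `δx`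
(minimal-image distance `Torus.euclidDist`) of the nominal point `x₀`. This file proves the position enclosure of
such a state at time `t`: it lies within `δx + |t - t₀| * δv` of the nominal free flight `x₀ + proj ((t - t₀) • v₀)`.
Design-independent; asserts no Theses decl.
-/

namespace Summit.AtomisticToContinuum.HydrodynamicLimit.Theorems.InfluenceLocality.Negative

open MeasureTheory Set
open scoped InnerProductSpace
open Literature.Analysis.FluidPDE Literature.MathematicalPhysics.KineticTheory
open Literature.Analysis.FunctionSpaces

noncomputable section

/-- TUBE ENCLOSURE. A state `(t, x, v)` of the free-flight tube with nominal data `(t₀, x₀, v₀)` and tolerances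
`(δx, δv)` — i.e. `‖v - v₀‖ ≤ δv` and the back-extrapolated position `x + proj ((t₀ - t) • v)` is within `δx` of
`x₀` — lies within `δx + |t - t₀| * δv` (minimal-image distance) of the nominal point `x₀ + proj ((t - t₀) • v₀)`.
Proof: `x = (x + proj ((t₀ - t) • v)) + proj ((t - t₀) • v)`, then `Torus.euclidDist_translate_le` and
`‖(t - t₀) • v - (t - t₀) • v₀‖ = |t - t₀| * ‖v - v₀‖ ≤ |t - t₀| * δv`. -/
theorem stub_tubeEnclosure (t₀ t : ℝ) (x₀ x : T3) (v₀ v : V3) (δx δv : ℝ)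
    (hv : ‖v - v₀‖ ≤ δv) (hx : Torus.euclidDist (x + Torus.proj ((t₀ - t) • v)) x₀ ≤ δx) :
    Torus.euclidDist x (x₀ + Torus.proj ((t - t₀) • v₀)) ≤ δx + |t - t₀| * δv := by
  -- rewrite `x` as the back-extrapolated point translated forward by `(t - t₀) • v`
  have hxeq : x = (x + Torus.proj ((t₀ - t) • v)) + Torus.proj ((t - t₀) • v) := by
    rw [add_assoc, ← Torus.proj_add, ← add_smul, show t₀ - t + (t - t₀) = 0 by ring, zero_smul,
      Torus.proj_zero, add_zero]
  have htr := Torus.euclidDist_translate_le (x + Torus.proj ((t₀ - t) • v)) x₀ ((t - t₀) • v) ((t - t₀) • v₀)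
  rw [← hxeq] at htr
  have hnorm : ‖(t - t₀) • v - (t - t₀) • v₀‖ ≤ |t - t₀| * δv := by
    rw [← smul_sub, norm_smul, Real.norm_eq_abs]
    exact mul_le_mul_of_nonneg_left hv (abs_nonneg _)
  linarith

end

end Summit.AtomisticToContinuum.HydrodynamicLimit.Theorems.InfluenceLocality.Negative
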